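import Mathlib
import Literature.MathematicalPhysics.QuantumManyBody.DyadicCoherentFraction
import Summits.AtomisticToContinuum.BoseEinsteinCondensation.Theses.BECTangentRigidity

/-!
# Birth skeleton — crux `MesoscopicFloor` (stmt-AtomisticToContinuum-13035),
# route `BECTangentRigidity` of `AtomisticToContinuum/BoseEinsteinCondensation`

Line `birth` (skeleton registrar, 2026-08-17): the crux as typed asks for SOME `N`-independent
window `ℓ > 0` (chosen after `ρ`), so it is reached by the kinetic-gap mechanism run at the
dyadic-cell scale `s = L/2^k ∈ [ℓ, 2ℓ)` with `ℓ ≲` healing length: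

* `stub_cellPoincare` — local Poincaré–Wirtinger (Neumann gap of the cube) on the dyadic partition,
  lifted to bosonic Dirichlet trial states: `N ≤ Σ_Q ⟨φ_Q, γ_Ψ φ_Q⟩ + C s² T(Ψ)`;
* `stub_energyCeiling` — a-priori `O(N)` bound on the Dirichlet ground-state energy along
  `L_N = (N/ρ)^{1/3}` at every small density (finite energy per particle in the dilute
  thermodynamic limit, hard cores included);
* `MesoscopicFloor_of_stubs : stub₁-sig → stub₂-sig → MesoscopicFloor` — the kernel-checked assembly
  (bookkeeping: `δ := 1`, `T ≤ energy ≤ E₀ + 1 ≤ (M+1)N`, and `ℓ := min 1 (1/(32 C (M+1)))` gives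
  `C s² (M+1) N ≤ N/8`, hence `cohSum ≥ 7N/8`), and `MesoscopicFloor_of : MesoscopicFloor` — the
  registered form, composing it with the two stubs BY NAME.

This is the line found by the crux attack of refuter-rattack-stmt-AtomisticToContinuum-13035-0
(evidence `BECTangentRigidityMesoscopicFloor.lean`, 2026-08-15): the window is unpinned, so the
floor holds at `ℓ ∼ ξ`; both stubs are provable from tree material
(`BoseGas.key_inequality`-type slicing in `BoseGasFreeDirichletBEC.lean`, `LSSY2005_lemma41_holds`;
`exists_density_cap_tendsto_e0` / `limsup_lt_top_of_small`).
-/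

noncomputable section

open MeasureTheory Filter
open scoped ENNReal NNReal

namespace Summit.AtomisticToContinuum.BoseEinsteinCondensation.Cruxes.MesoscopicFloor.Birth

open Literature.MathematicalPhysics.QuantumManyBody.BoseGas

/-- **Stub 1 (dyadic-cell Poincaré for bosonic trial states).** There is a universal constant
`C > 0` such that for every box side `L > 0`, every dyadic level `k` (cells of side `s = L/2^k`
partitioning `[0,L)³ ⊇ Λ_L`) and every bosonic Dirichlet trial state `Ψ` of `N` particles in `Λ_L`,
`N ≤ Σ_Q ⟨φ_Q, γ_Ψ φ_Q⟩ + C s² ∫ |∇Ψ|²`: every particle is either in the flat mode of its own cell or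
kinetically excited at the cell's Neumann gap `π²/s²` (sharp constant `C = π⁻²`). One-body input:
the Neumann Poincaré–Wirtinger inequality of the cube applied to the slices `x ↦ Ψ(x, Y)` on each
cell, summed over the partition, integrated in `Y` and multiplied by `N` via Bose symmetry
(`T = N ∫|∇₁Ψ|²`). Size M. Leans on: `BoseGas.local_poincare_cellShift`, `BoseGas.slice_key` /
`key_inequality` pattern (`BoseGasFreeDirichletBEC.lean`), or `LSSY2005_lemma41_holds` (`Ω = K`),
`occupation`, `cohSum`, `dyMode`, `integral_conj_dyMode_mul`. -/
theorem stub_cellPoincare :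
    ∃ C : ℝ, 0 < C ∧ ∀ (N : ℕ) (L : ℝ), 0 < L → ∀ (k : ℕ) (Ψ : TrialState N L),
      ENNReal.ofReal (N : ℝ) ≤ cohSum N L k Ψ.ψ +
        ENNReal.ofReal (C * (L / 2 ^ k) ^ 2) * ∫⁻ X, kineticDensity Ψ.ψ X := by
  sorry

/-- **Stub 2 (Dirichlet energy ceiling in the dilute thermodynamic limit).** For every repulsive
finite-range `v` there is `ρ₀ > 0` such that for every density `0 < ρ < ρ₀` the Dirichlet
ground-state energy of `N` bosons in the box of side `L_N = (N/ρ)^{1/3}` is `O(N)`: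
`E₀^D(N, L_N) ≤ M N` for all large `N`, some `M = M(v, ρ) > 0` (finite energy per particle below
close packing — hard cores are admitted by `IsRepulsiveFiniteRange`, whence the density cap; e.g.
`ρ₀ = 1/(2(1+R)³)`, `M = e₀(ρ) + 1`). Size S–M. Leans on: `exists_density_cap_tendsto_e0`
(`BoseGasDiluteEnergyFloor.lean`), `limsup_lt_top_of_small` (`BoseGasThermodynamicLimitRuelle.lean`),
`energyPerParticleDirichlet`. -/
theorem stub_energyCeiling :
    ∀ v : ℝ → ℝ≥0∞, IsRepulsiveFiniteRange v → ∃ ρ₀ : ℝ, 0 < ρ₀ ∧ ∀ ρ : ℝ, 0 < ρ → ρ < ρ₀ →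
      ∃ M : ℝ, 0 < M ∧ ∀ᶠ N : ℕ in atTop,
        groundStateEnergy v N (sideLength ρ N) ≤ ENNReal.ofReal (M * N) := by
  sorry

/-- **Assembly of the line, implication form** (real proof, no `sorry`; axioms `propext`,
`Classical.choice`, `Quot.sound` only): stub 1 → stub 2 → the crux `BECTangentRigidity.MesoscopicFloor`
BY NAME. Bookkeeping only: `δ := 1`; `∫|∇Ψ|² ≤ energy v Ψ ≤ E₀ + 1 ≤ (M+1) N` for `N ≥ 1`; the window
`ℓ := min 1 (1/(32 C (M+1)))` makes `C s² (M+1) N ≤ N/8` for every cell side `s < 2ℓ`, so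
`N ≤ cohSum + N/8`, i.e. `cohSum ≥ 7N/8`; the hypothesis `ℓ ≤ s` of the crux is not needed. -/
theorem MesoscopicFloor_of_stubs :
    (∃ C : ℝ, 0 < C ∧ ∀ (N : ℕ) (L : ℝ), 0 < L → ∀ (k : ℕ) (Ψ : TrialState N L),
      ENNReal.ofReal (N : ℝ) ≤ cohSum N L k Ψ.ψ +
        ENNReal.ofReal (C * (L / 2 ^ k) ^ 2) * ∫⁻ X, kineticDensity Ψ.ψ X) →
    (∀ v : ℝ → ℝ≥0∞, IsRepulsiveFiniteRange v → ∃ ρ₀ : ℝ, 0 < ρ₀ ∧ ∀ ρ : ℝ, 0 < ρ → ρ < ρ₀ →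
      ∃ M : ℝ, 0 < M ∧ ∀ᶠ N : ℕ in atTop,
        groundStateEnergy v N (sideLength ρ N) ≤ ENNReal.ofReal (M * N)) →
    Summit.AtomisticToContinuum.BoseEinsteinCondensation.Theses.BECTangentRigidity.MesoscopicFloor := by
  rintro ⟨C, hC, hP⟩ hE v hv
  obtain ⟨ρ₀, hρ₀, hρ⟩ := hE v hv
  refine ⟨ρ₀, hρ₀, fun ρ hρpos hρlt => ?_⟩
  obtain ⟨M, hM, hEv⟩ := hρ ρ hρpos hρlt
  -- the window `ℓ`: any `0 < ℓ ≤ 1` with `32 C (M+1) ℓ ≤ 1`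
  have hA : (0 : ℝ) < 32 * C * (M + 1) := by positivity
  obtain ⟨ℓ, hℓpos, hℓ1, hℓ2⟩ : ∃ ℓ : ℝ, 0 < ℓ ∧ ℓ ≤ 1 ∧ ℓ * (32 * C * (M + 1)) ≤ 1 :=
    ⟨min 1 (1 / (32 * C * (M + 1))), lt_min one_pos (by positivity), min_le_left _ _,
      (le_div_iff₀ hA).1 (min_le_right _ _)⟩
  refine ⟨ℓ, hℓpos, ?_⟩
  filter_upwards [hEv, eventually_ge_atTop 1] with N hEN hN1
  refine ⟨1, one_pos, fun Ψ hΨ k _hk1 hk2 => ?_⟩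
  have hN1' : (1 : ℝ) ≤ N := by exact_mod_cast hN1
  have hLpos : 0 < sideLength ρ N := by
    unfold sideLength
    exact Real.rpow_pos_of_pos (div_pos (by linarith) hρpos) _
  have hs0 : 0 ≤ sideLength ρ N / 2 ^ k := by positivity
  -- kinetic energy ≤ total energy ≤ E₀ + 1 ≤ (M + 1) N
  have hT : ∫⁻ X, kineticDensity Ψ.ψ X ≤ ENNReal.ofReal ((M + 1) * N) := by
    have h1 : (1 : ℝ≥0∞) ≤ ENNReal.ofReal (N : ℝ) := by
      rw [← ENNReal.ofReal_one]
      exact ENNReal.ofReal_le_ofReal hN1'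
    calc ∫⁻ X, kineticDensity Ψ.ψ X ≤ energy v Ψ := by
          unfold energy
          exact lintegral_mono fun X => le_self_add
      _ ≤ groundStateEnergy v N (sideLength ρ N) + 1 := hΨ
      _ ≤ ENNReal.ofReal (M * N) + ENNReal.ofReal (N : ℝ) := add_le_add hEN h1
      _ = ENNReal.ofReal ((M + 1) * N) := by
          rw [← ENNReal.ofReal_add (by positivity) (by positivity)]
          congr 1
          ring
  -- the real arithmetic: `C s² (M+1) N ≤ N/8` for `s < 2ℓ`
  have hCM : 0 ≤ C * (M + 1) := by positivity
  have hs2 : (sideLength ρ N / 2 ^ k) ^ 2 ≤ (2 * ℓ) ^ 2 := pow_le_pow_left₀ hs0 hk2.le 2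
  have hℓsq : ℓ ^ 2 ≤ ℓ := by nlinarith
  have e1 := mul_le_mul_of_nonneg_right hs2 hCM
  have e2 := mul_le_mul_of_nonneg_right hℓsq hCM
  have hbound : C * (sideLength ρ N / 2 ^ k) ^ 2 * ((M + 1) * N) ≤ (N : ℝ) / 8 := by
    have hsmall : C * (sideLength ρ N / 2 ^ k) ^ 2 * (M + 1) ≤ 1 / 8 := by
      have e3 : C * (sideLength ρ N / 2 ^ k) ^ 2 * (M + 1) =
          (sideLength ρ N / 2 ^ k) ^ 2 * (C * (M + 1)) := by ring
      rw [e3]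
      nlinarith [e1, e2, hℓ2]
    calc C * (sideLength ρ N / 2 ^ k) ^ 2 * ((M + 1) * (N : ℝ))
        = (C * (sideLength ρ N / 2 ^ k) ^ 2 * (M + 1)) * (N : ℝ) := by ring
      _ ≤ (1 / 8 : ℝ) * (N : ℝ) := by gcongr
      _ = (N : ℝ) / 8 := by ring
  -- Poincaré on the cells of level `k`, then absorb the kinetic term
  have hmain : ENNReal.ofReal (N : ℝ) ≤
      cohSum N (sideLength ρ N) k Ψ.ψ + ENNReal.ofReal ((N : ℝ) / 8) := by
    calc ENNReal.ofReal (N : ℝ)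
        ≤ cohSum N (sideLength ρ N) k Ψ.ψ +
            ENNReal.ofReal (C * (sideLength ρ N / 2 ^ k) ^ 2) * ∫⁻ X, kineticDensity Ψ.ψ X :=
          hP N (sideLength ρ N) hLpos k Ψ
      _ ≤ cohSum N (sideLength ρ N) k Ψ.ψ +
            ENNReal.ofReal (C * (sideLength ρ N / 2 ^ k) ^ 2) * ENNReal.ofReal ((M + 1) * N) := by
          gcongr
      _ = cohSum N (sideLength ρ N) k Ψ.ψ +
            ENNReal.ofReal (C * (sideLength ρ N / 2 ^ k) ^ 2 * ((M + 1) * N)) := by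
          rw [← ENNReal.ofReal_mul (by positivity)]
      _ ≤ cohSum N (sideLength ρ N) k Ψ.ψ + ENNReal.ofReal ((N : ℝ) / 8) := by
          gcongr
  have hfin : ENNReal.ofReal (7 * (N : ℝ) / 8) ≤ cohSum N (sideLength ρ N) k Ψ.ψ := by
    have h78 : 7 * (N : ℝ) / 8 = N - N / 8 := by ring
    rw [h78, ENNReal.ofReal_sub _ (by positivity)]
    exact tsub_le_iff_right.2 hmain
  simpa only [cohSum_eq] using hfin

/-- **The skeleton theorem (registered form):** the crux `BECTangentRigidity.MesoscopicFloor` BY NAME,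
from the two stubs BY NAME through `MesoscopicFloor_of_stubs` — no `sorry` of its own; its only
`sorryAx` ancestry is `stub_cellPoincare`, `stub_energyCeiling`. -/
theorem MesoscopicFloor_of :
    Summit.AtomisticToContinuum.BoseEinsteinCondensation.Theses.BECTangentRigidity.MesoscopicFloor :=
  MesoscopicFloor_of_stubs stub_cellPoincare stub_energyCeiling

end Summit.AtomisticToContinuum.BoseEinsteinCondensation.Cruxes.MesoscopicFloor.Birth

end
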